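/-
Origin: expansion seat `prover-pub-hodgecm-mc-binder-2-g20-0`, handover #106 2026-08-21T04:20Z md5 038081995371 (NEW; 368 l.; SLOTS 2 AND 3, literally the slot-0∕1 file with hGR₂ ∕ hGR₃, χ₂ ∕ χ₃, dW' c.D 0 ∕ 1 (= c.D.a 2 ∕ 3 by rfl), lineOmega_two∕three, binder-1 pinDatum{Two,Three}G (slot 3's datum takes no h₁W) + #R130 …_pin{Two,Three}G, sinst-1 #1268–#1271 splitLine{Two,Three}TwistedG ∕ char{Two,Three}DictG ∕ dictEquiv{Two,Three}CanonicalG ∕ isAutChar_char{Two,Three}DictG_of_weight (slot 3's names adelicCharThree ∕ bigCharThree carry no G); abbrev a{Two,Three}J; splitLine{Two,Three}TwistedG_eq_ofCMOf_twistBy ∕ _scalar; **hJ_slot_{two,three}_of_lineRepOf** with the slot-2∕3 hypotheses of the same shape (hμ over centralTypeOf V a_k hGR_k, hw over torusScalar_{two,three}G V c.D hGR hGR₂ hGR₃ χ_k). CERT as row #105 (staged sinst-1 #1268 e8f8389db4f9 ∕ #1269 c40ac7cb969c ∕ #1270 503fb57f1c6e ∕ #1271 14aa2efe46dc): rc 0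 ∕ 40 s ∕ 0 warn ∕ 0 proof holes; axioms in the same log 2d593f699efc. NAME LIST (theorems): HodgeCM.Model.ThetaAdelicSide.hJ_slot_two_of_lineRepOf · HodgeCM.Model.ThetaAdelicSide.hJ_slot_three_of_lineRepOf · HodgeCM.Model.ThetaAdelicSide.splitLineThreeTwistedG_scalar. (`HOME/mc/pub-hodgecm-mc-binder-2/g20/stage72/HodgeCM/Model/Binders/JLiuSlots23.lean`, md5 038081995371, 367 lines);
landed by the second packager p2 gen 18 (p2-g18) in gate run 72 as `HodgeCM/Model/Binders/JLiuSlots23.lean` (verbatim).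
-/
/-
Origin: BINDER seat `prover-pub-hodgecm-mc-binder-2-g20-0` (unit pub-hodgecm-mc-binder-2-g20, gen 20 of mc-binder-2), 2026-08-21.
Target in PKG: `HodgeCM/Model/Binders/JLiuSlots23.lean` (NEW additive KERNEL leaf beside E; imports binder-2 #104 `Model/Binders/JLiuBlockFamily`,
binder-1 #R130 `Model/AdelicThetaDistributionMultSpanG` (→ #R129 ∕ #R128), sinst-1 #1269 ∕ #1271 `Model/AdelicThetaSlot{Two,Three}AutG`,
theta-3 #S19 `Model/LiuIndexTwistTypeOfV` — all RUN-71 rows; nothing imports it; outside E's ∕ «AR»'s import closure; MODEL-N ±0).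
KERNEL ONLY: theorems + four reducible `abbrev`s (the slot scalars as `RealScalar`s); 0 records, nothing cited, 0 `def … : Prop`.
Nothing here is a claim of the manuscripts under adjudication.
-/
import Summits.HodgeConjecture.HodgeCM.Model.Binders.JLiuBlockFamily
import Summits.HodgeConjecture.HodgeCM.Model.AdelicThetaDistributionMultSpanG_2
import Summits.HodgeConjecture.HodgeCM.Model.AdelicThetaSlotTwoAutG
import Summits.HodgeConjecture.HodgeCM.Model.AdelicThetaSlotThreeAutG
import Summits.HodgeConjecture.HodgeCM.Model.LiuIndexTwistTypeOfV

set_option autoImplicit false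

/-!
# (J3) THE JUNCTION BINDER `hJ`, SLOTS 2 AND 3, PIN-GENERICALLY (companion file: the other two slots) — the five lanes' pieces composed

For ANY adelic side `S : ThetaAdelicSide V c` whose slot-`k` line representation reads back to `lineRepOf … χ₀ χ₁ χ₂ χ₃ k` (binder-1 #R128 ∕
#R129's currency; at the R2 pin of record `χ_k := etaT_k η ν(′)`, sinst-1 #1263 ∕ binder-1 #R131) and any side FAMILY `Sf` with `Sf V c = S`
(E quantifies a family), `hJ_slot_{zero,one,two,three}_of_lineRepOf` proves the slot-`k` conjunct of the junction binder `hJ` of the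
junction-form E child («ATqI», binder-2-g20 draft): ONE index `j_k` of theta-3's enumeration `LiuIndex.I V (LiuIndex.repAt a_k) μ` (#S15 r2 ∕
#S16 r2 ∕ #S18 ∕ #S19, pointed by binder-2 #103 at the slot scalar `a_k`) — the index of the χ_k-TWISTED slot record `splitLine_kTwistedG … χ_k`
(sinst-1 #1264 ∕ #1266 ∕ #1268 ∕ #1270) — isometric to `a_k = c.D.a k`, such that EVERY theta class
`ω ∈ thetaOf _ (thetaClassInputOf _ (thetaSpaceInputOf … Sf)) V c k Γ` (E's theta model, `Γ` below conj-three) is `res cf` of a tower vector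
`cf` of level `Γ` with `ofLevel cf ∈ block j_k` of the pinned dictionary (#102 `liuDictionaryPin`).  The slot scalars `⟨dW c.D k, …⟩` ∕
`⟨dW' c.D k, …⟩` (k = 0,1) ARE «ATqI»'s `⟨c.D.a i, c.D.a_real i, c.D.a_ne i⟩` (i = k ∕ k+2) definitionally.

HYPOTHESES per slot (all named; none archimedean-analytic beyond the pin's own identities): binder-1 #R129's pin block `hemb eR eS hχ a hω
hdefI` at `χ_k`; the side facts `hGfin` ∕ `hLF`; `hη₁V` ∕ `hη₁W` (rational triviality of `χ_k`), `hc₁` (continuity of `adelicChar_k χ_k`);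
and the slot's ONE archimedean identity in its two currencies — `hμ` (the recipe value `μ ⟦a_k⟧`, theta-3 #S19's split form) and `hw`
((Hw_k′), sinst-1 ∕ carch #CA70 (CC_k)).  At the R2 pin all of these but `hμ` are discharged by PKG names (binder-1 #R131, sinst-1 #1272 ∕
#1273, carch #CA72 ∕ #CA73; binder-2 probe `SlotOneR2`).

PIECES, by name: sinst-1 #1238 `exists_fixed_adelic_lift_of_mem_thetaOf`; binder-1 #R130 `clsU_mem_iSup_block_of_mem_adelicThetaSpanSat_pin_kG`
(over #R128 §1 ∕ #R129 `pinDatum_kG`), #1242 ∕ #1243 tower (`towerFamily_mem`, `res_towerFamily`, `clsU_eq_clsAt`, `clsAt_apply`,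
`mem_holSatU_iff`, `mem_holSat_iff`); theta-3 #S19 `LiuIndex.I.exists_line_eq_twistBy_bigCharOfV_of_eq`; sinst-1 `dictEquiv_kCanonicalG`,
`isAutChar_char_kDictG_of_weight`; binder-2 #103 `exists_isometric_of_line_eq`, #104 `mem_biSup_block_pin_of_line_eq_of_mem_biSup`.
`#print axioms` ⊆ {propext, Classical.choice, Quot.sound}.
-/

noncomputable section

open NumberField hiding relNormOneIdeles relNormOneRat probHaarRelNormOneQuot
open _root_.NumberField.InfinitePlace _root_.NumberField.mixedEmbedding MeasureTheory MulAction IsDedekindDomain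
open scoped Matrix TensorProduct Classical SchwartzMap
open Literature.Geometry.ComplexHyperbolic.BallModel (U21 x₀ stabilizerEquivK21)
open Literature.NumberTheory.Automorphic.U21 (K21 matA sclD)
open Literature.NumberTheory.Automorphic Literature.NumberTheory.Automorphic.UnitaryGroup Literature.NumberTheory.Weil1964
open Literature.NumberTheory.GelbartRogawski1991 Literature.NumberTheory.GelbartRogawski1991.UnitaryDualPair
open Literature.AlgebraicGeometry.HodgeTheory Literature.AlgebraicGeometry.ShimuraVarieties Literature.AlgebraicGeometry.ShimuraVarieties.BallForms
open Literature.NumberTheory.Automorphic.PicardCM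
open Literature.NumberTheory.Transcendental (Arapura2012_Cor_15_4_6)
open Literature.Analysis.SegalBargmann
open HodgeCM.Adelic HodgeCM.PerL34 HodgeCM.Model.HypCensus HodgeCM.Model.ArchSideTerm HodgeCM.Model.ThetaDistFin HodgeCM.Model.TowerCarrier
open HodgeCM.Model.SupplyInstance HodgeCM.Model.SupplyResidual HodgeCM.Model.ThetaSpace
open HodgeCM.Model.SupplyResidual.WeilPairData (charInv)

open HodgeCM.Model.TowerLevel HodgeCM.Model.TowerCarrier

namespace HodgeCM.Model
namespace ThetaAdelicSide

variable (hHD : exists_isReal_hodgeModel) (hI : hodgePQ_independent_of_hodgeModel)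
  (h₁ : BallQuotientUniformised) (h₃ : CMAbelianVarietyRealised) (hA : Arapura2012_Cor_15_4_6)
variable {L : CMField} {ι₁ : L →+* ℂ} (V : HermSpace3 L ι₁) (c : SeesawCtx L) (S : ThetaAdelicSide V c)
  (hGR : (cmSplittingDatum (L : Type) finProdFinEquiv (frameD V) (frameD_real V) (frameD_ne V) (dW c.D) (dW_real c.D)
    (dW_ne c.D)).CompatibleSplitting)
  (hGR₀ : (cmSplittingDatum (L : Type) (e₁) (frameD V) (frameD_real V) (frameD_ne V) (lineVec (L : Type) (dW c.D 0))
    (fun _ => dW_real c.D 0) (fun _ => dW_ne c.D 0)).CompatibleSplitting)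
  (hGR₁ : (cmSplittingDatum (L : Type) (e₁) (frameD V) (frameD_real V) (frameD_ne V) (lineVec (L : Type) (dW c.D 1))
    (fun _ => dW_real c.D 1) (fun _ => dW_ne c.D 1)).CompatibleSplitting)
  (hGR₂ : (cmSplittingDatum (L : Type) (e₁) (frameD V) (frameD_real V) (frameD_ne V) (lineVec (L : Type) (dW' c.D 0))
    (fun _ => dW'_real c.D 0) (fun _ => dW'_ne c.D 0)).CompatibleSplitting)
  (hGR₃ : (cmSplittingDatum (L : Type) (e₁) (frameD V) (frameD_real V) (frameD_ne V) (lineVec (L : Type) (dW' c.D 1))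
    (fun _ => dW'_real c.D 1) (fun _ => dW'_ne c.D 1)).CompatibleSplitting)
  (χ₀ χ₁ χ₂ χ₃ : CMAdelic (L : Type) (frameD V) × CMAdelicOne (L : Type) →* ℂˣ)
  (hι : S.ιinf = archInfOf V)
  (h₁W : (∀ j, 0 < (ι₁ (dW c.D j)).re) ∨ ∀ j, (ι₁ (dW c.D j)).re < 0)
  (hV : IsAnisotropic L V.Hm)
  (hemb : (InfinitePlace.mk ι₁).embedding = ι₁)

variable (μ : LiuIndex.GramClass L → InfinitePlace (L : Type) → ℤ)

/-! ## Slot 2 -/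

section Two

variable (hP : (S.P 2).ω = lineRepOf V c.D hGR hGR₀ hGR₁ hGR₂ hGR₃ χ₀ χ₁ χ₂ χ₃ 2)
  (hχc : Continuous fun p => ((χ₂ p : ℂˣ) : ℂ))
  (eR : PosIdx (cmXW (L : Type) (frameD V) (lineVec (L : Type) (dW' c.D 0)) (fun _ => dW'_real c.D 0) ι₁ (HypCensus.cmPlace (L : Type) ι₁)) ≃ Unit)
  (eS : NegIdx (cmXW (L : Type) (frameD V) (lineVec (L : Type) (dW' c.D 0)) (fun _ => dW'_real c.D 0) ι₁ (HypCensus.cmPlace (L : Type) ι₁)) ≃ Empty)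
  (hχ : ∀ u : stabilizer U21 x₀,
    ((lineScalar_two V c.D hGR hGR₂ hGR₃ χ₂ (u : U21) : ℂˣ) : ℂ) *
        ((matA (stabilizerEquivK21.symm u)).det ^ (lineVacExponentsTwo V c hGR₂ eR eS).eP *
          sclD (stabilizerEquivK21.symm u) ^ (lineVacExponentsTwo V c hGR₂ eR eS).eQ) =
      star (sclD (stabilizerEquivK21.symm u)))
  (a : {v : InfinitePlace ↥(maximalRealSubfield L) // v.IsReal} → ℤ)
  (hω : ∀ b : {v : InfinitePlace ↥(maximalRealSubfield L) // v.IsReal}, b ≠ HypCensus.cmPlace (L : Type) ι₁ →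
    ∀ (u : UnitaryGroup.archLocal (L : Type) 3 (Matrix.diagonal (frameD V)) (cmPlaceOver (L : Type) b)) (ℓ : Module.Dual ℂ (Fin 2 → ℂ)),
      cmArchWeilRep (L : Type) e₁ (frameD V) (frameD_real V) (frameD_ne V) (lineVec (L : Type) (dW' c.D 0)) (fun _ => dW'_real c.D 0)
          (fun _ => dW'_ne c.D 0) hGR₂
          (UnitaryGroup.archSingle (↥(maximalRealSubfield L)) L (IsCMField.complexConj L) 3 (Matrix.diagonal (frameD V))
            (IsCMField.complexConj_ne_one L) (NumberField.complexConj_smul_infinitePlace (L : Type)) (cmPlaceOver (L : Type) b) u, 1)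
          (blockFamilyOfAt (L : Type) e₁ (frameD V) (frameD_real V) (frameD_ne V) (lineVec (L : Type) (dW' c.D 0)) (fun _ => dW'_real c.D 0)
            (fun _ => dW'_ne c.D 0) ι₁ (blockPosEquiv V) (blockNegEquiv V) eR eS (degOnePDual Empty) (binvPi 1) ℓ) =
        (((u : UnitaryGroup.archLocal (L : Type) 3 (Matrix.diagonal (frameD V)) (cmPlaceOver (L : Type) b)) : GL (Fin 3) ℂ) :
            Matrix (Fin 3) (Fin 3) ℂ).det ^ a b •
          blockFamilyOfAt (L : Type) e₁ (frameD V) (frameD_real V) (frameD_ne V) (lineVec (L : Type) (dW' c.D 0)) (fun _ => dW'_real c.D 0)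
            (fun _ => dW'_ne c.D 0) ι₁ (blockPosEquiv V) (blockNegEquiv V) eR eS (degOnePDual Empty) (binvPi 1) ℓ)
  (hdefI : ∀ b : {v : InfinitePlace ↥(maximalRealSubfield L) // v.IsReal}, b ≠ HypCensus.cmPlace (L : Type) ι₁ →
    ∀ u : UnitaryGroup.archLocal (L : Type) 3 (Matrix.diagonal (frameD V)) (cmPlaceOver (L : Type) b),
      ((archScalar_twoG V c.D hGR hGR₂ hGR₃ χ₂
          (UnitaryGroup.archSingle (↥(maximalRealSubfield L)) L (IsCMField.complexConj L) 3 (Matrix.diagonal (frameD V))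
            (IsCMField.complexConj_ne_one L) (NumberField.complexConj_smul_infinitePlace (L : Type)) (cmPlaceOver (L : Type) b) u) : ℂˣ) : ℂ) *
        (((u : UnitaryGroup.archLocal (L : Type) 3 (Matrix.diagonal (frameD V)) (cmPlaceOver (L : Type) b)) : GL (Fin 3) ℂ) :
            Matrix (Fin 3) (Fin 3) ℂ).det ^ a b = 1)



/-- the slot-2 scalar as a `RealScalar`. -/
abbrev aTwoJ : LiuIndex.RealScalar L := ⟨dW' c.D 0, dW'_real c.D 0, dW'_ne c.D 0⟩

/-- sinst-1's twisted slot-2 record IS (#102 `ofCMOf` at `a_2`) twisted by its big character — definitional (`delta` + `rfl`). [folklore] -/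
theorem splitLineTwoTwistedG_eq_ofCMOf_twistBy (hη₁V : ∀ v ∈ CMRat (L : Type) (frameD V), χ₂ (v, 1) = 1) :
    splitLineTwoTwistedG V c hGR hGR₂ hGR₃ χ₂ hη₁V =
      (SplitLineE.ofCMOf V e₁ (LiuIndex.RealScalar.vec (aTwoJ c)) (LiuIndex.RealScalar.vec_real (aTwoJ c))
        (LiuIndex.RealScalar.vec_ne (aTwoJ c)) hGR₂).twistBy (bigCharTwoG V c hGR hGR₂ hGR₃ χ₂)
        (bigCharTwoG_isRatTrivial V c hGR hGR₂ hGR₃ χ₂ hη₁V) := by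
  delta ThetaAdelicSide.splitLineTwoTwistedG ThetaAdelicSide.splitLineTwoG
  rfl

/-- the twisted slot-2 record's Gram scalar is `c.D.a 2`. [folklore] -/
theorem splitLineTwoTwistedG_scalar (hη₁V : ∀ v ∈ CMRat (L : Type) (frameD V), χ₂ (v, 1) = 1) :
    (splitLineTwoTwistedG V c hGR hGR₂ hGR₃ χ₂ hη₁V).scalar = c.D.a 2 := by
  rw [splitLineTwoTwistedG_eq_ofCMOf_twistBy]
  show (SplitLineE.ofCMOf V e₁ (LiuIndex.RealScalar.vec (aTwoJ c)) (LiuIndex.RealScalar.vec_real (aTwoJ c))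
        (LiuIndex.RealScalar.vec_ne (aTwoJ c)) hGR₂).scalar = c.D.a 2
  rw [SplitLineE.ofCMOf_scalar]
  rfl

include hGR hGR₀ hGR₁ hGR₂ hGR₃ χ₀ χ₁ χ₂ χ₃ hι h₁W hP hχc hemb eR eS hχ a hω hdefI in
/-- **SLOT 2 OF THE JUNCTION BINDER `hJ`, PIN-GENERICALLY, FOR E's THETA MODEL** over any side family `Sf` with `Sf V c = S`, `S` reading
`lineRepOf … χ₀ χ₁ χ₂ χ₃` at slot 2 (R2 pin: `χ₁ := etaT₁ η ν`): the slot-2 conjunct through the χ₁-TWISTED record, `T := {j₁}`,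
modulo the ONE archimedean identity (`hμ` index side in #S19's split currency ∕ `hw` automorphy side, (Hw₁′)), the pin identities, and the
side facts `hGfin` ∕ `hLF` ∕ `hη₁V` ∕ `hη₁W`. -/
theorem hJ_slot_two_of_lineRepOf
    (Sf : ∀ {L : CMField} {ι₁ : L →+* ℂ} (V : HermSpace3 L ι₁) (c : SeesawCtx L), ThetaAdelicSide V c)
    (hS : Sf V c = S)
    (hGfin : ∀ K : Subgroup ↥V.adelicFin, ThetaDistDatum.satG hV K ≤ S.Gfin) (hLF : (S.P 2).IsLFAction)
    (hη₁V : ∀ v ∈ CMRat (L : Type) (frameD V), χ₂ (v, 1) = 1)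
    (hη₁W : ∀ t₀ ∈ relNormOneRat (↥(maximalRealSubfield L)) L, χ₂ (1, (cmAdelicOneEquivRelNormOne (L : Type)).symm t₀) = 1)
    (hc₁ : Continuous fun v => ((adelicCharTwoG V c hGR hGR₂ hGR₃ χ₂ v : ℂˣ) : ℂ))
    (hμ : μ (LiuIndex.GramClass.mk (aTwoJ c)) =
      Literature.NumberTheory.Automorphic.charArchType (L : Type) (LiuIndex.centerCharInf V (adelicCharTwoG V c hGR hGR₂ hGR₃ χ₂))
          (LiuIndex.continuous_centerCharInf V _ hc₁) +
        LiuIndex.centralTypeOf V (aTwoJ c) hGR₂)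
    (hw : ∀ t : ↥(Literature.NumberTheory.Automorphic.relNormOneInfUnits (↥(maximalRealSubfield L)) L),
      (S.P 2).w t *
          ((adelicCharTwoG V c hGR hGR₂ hGR₃ χ₂ (CMCenter (L : Type) (frameD V)
            ((cmAdelicOneEquivRelNormOne (L : Type)).symm (Literature.NumberTheory.Automorphic.relNormOneInfToIdeles (↥(maximalRealSubfield L)) L t))) : ℂˣ) : ℂ) =
        ((torusScalar_twoG V c.D hGR hGR₂ hGR₃ χ₂
            ((cmAdelicOneEquivRelNormOne (L : Type)).symm (Literature.NumberTheory.Automorphic.relNormOneInfToIdeles (↥(maximalRealSubfield L)) L t)) : ℂˣ) : ℂ)) :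
    ∃ T : Finset (LiuIndex.I V (LiuIndex.repAt (aTwoJ c)) μ),
      (∀ j ∈ T, ∃ z : (L : Type), z ≠ 0 ∧
        (LiuIndex.line V (LiuIndex.repAt (aTwoJ c)) μ j).scalar = z * conjRingHomK L z * c.D.a 2) ∧
      ∀ (Γ : Level V) (hΓ : Γ.BelowConjThree),
        ∀ ω ∈ thetaOf _ (thetaClassInputOf _ (fun V c => thetaSpaceInputOf hHD hI h₁ h₃ Sf V c)) V c 2 Γ,
          ∃ cf : towerLevel hHD hI (ballQuotientUniformisedDatum_of h₁) h₃ hA Γ hΓ,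
            TowerLevel.res hHD hI (ballQuotientUniformisedDatum_of h₁) h₃ hA cf = ω ∧
              (ofLevel hHD hI (ballQuotientUniformisedDatum_of h₁) h₃ hA Γ hΓ cf :
                  (liuDictionaryPin hHD hI h₁ h₃ hA V (LiuIndex.I V (LiuIndex.repAt (aTwoJ c)) μ)
                    (LiuIndex.line V (LiuIndex.repAt (aTwoJ c)) μ)).H) ∈
                ⨆ j' ∈ T, (liuDictionaryPin hHD hI h₁ h₃ hA V (LiuIndex.I V (LiuIndex.repAt (aTwoJ c)) μ)
                  (LiuIndex.line V (LiuIndex.repAt (aTwoJ c)) μ)).block j' := by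
  -- theta-3 #S19: THE index of the twisted slot record, ONCE
  obtain ⟨j, hj1, hline⟩ : ∃ j : LiuIndex.I V (LiuIndex.repAt (aTwoJ c)) μ, j.1 = LiuIndex.GramClass.mk (aTwoJ c) ∧
      LiuIndex.line V (LiuIndex.repAt (aTwoJ c)) μ j = splitLineTwoTwistedG V c hGR hGR₂ hGR₃ χ₂ hη₁V := by
    rw [splitLineTwoTwistedG_eq_ofCMOf_twistBy]
    exact LiuIndex.I.exists_line_eq_twistBy_bigCharOfV_of_eq V μ (LiuIndex.repAt_mk_self (aTwoJ c)) hGR₂ _ _ hc₁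
      (bigCharTwoG_isRatTrivial V c hGR hGR₂ hGR₃ χ₂ hη₁V) hμ
  refine ⟨{j}, fun j' hj' => ?_, fun Γ hΓ θ hθ => ?_⟩
  · rw [Finset.mem_singleton] at hj'
    subst hj'
    exact exists_isometric_of_line_eq V _ _ hline (splitLineTwoTwistedG_scalar V c hGR hGR₂ hGR₃ χ₂ hη₁V)
  -- sinst-1 #1238: the (J4) lift of the theta class (over the family `Sf`), moved to `S`
  obtain ⟨cl, hclω, -, F, hFsat₀, hpull₀, -⟩ := exists_fixed_adelic_lift_of_mem_thetaOf hHD hI h₁ h₃ Sf V c 2 Γ hV hθ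
  have hFsat : (F : (V.latticeModel printFact_unitaryCompact_holds).G → (Fin 2 → ℂ)) ∈
      adelicThetaSpanSat (S.P 2) S.ιinf (stabilizer U21 x₀).subtype
        (BallForms.isPullbackCocycle_cotangentCocycle.weightOf x₀) (ThetaDistDatum.satG hV Γ.K) (S.P 2).weightFunctions := by
    rw [← hS]; exact hFsat₀
  have hpull : (((pinD hHD hI h₁ h₃ Γ hV).pull cl : weightForms _ _ _) : U21 → Fin 2 → ℂ) =
      (F : (V.latticeModel printFact_unitaryCompact_holds).G → (Fin 2 → ℂ)) ∘ ⇑S.ιinf := by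
    rw [← hS]; exact hpull₀
  have h𝓕 : ∀ f ∈ (S.P 2).weightFunctions,
      ∃ χ : PontryaginDual (↥(relNormOneIdeles (↥(maximalRealSubfield L)) L) ⧸ relNormOneRat (↥(maximalRealSubfield L)) L),
        f = charInv χ := fun f ⟨χ, _, hf⟩ => ⟨χ, hf⟩
  -- binder-1 #R130 at #R129's pin-generic datum
  obtain ⟨hF', hx⟩ := clsU_mem_iSup_block_of_mem_adelicThetaSpanSat_pinTwoG hHD hI h₁ h₃ hA V c S hGR hGR₀ hGR₁ hGR₂ hGR₃
    χ₀ χ₁ χ₂ χ₃ hι h₁W hV hemb hP hχc eR eS hχ a hω hdefI h𝓕 hGfin hLF Γ.K hFsat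
  have hhol : IsHolGerm S.ιinf (F : (V.latticeModel printFact_unitaryCompact_holds).G → (Fin 2 → ℂ)) := by
    obtain ⟨i, hi⟩ := (S.mem_holSatU_iff hV 2).1 hF'
    exact ((S.mem_holSat_iff hV 2 i.1).1 hi).2
  -- binder-1 #1242∕#1243: tower vector and restriction
  refine ⟨⟨_, S.towerFamily_mem hHD hI h₁ h₃ hA hι hV hΓ hFsat hhol⟩, ?_, ?_⟩
  · rw [← hclω]
    exact S.res_towerFamily hHD hI h₁ h₃ hA hV hΓ hFsat hhol _ cl hpull
  have hFΓ : (F : (V.latticeModel printFact_unitaryCompact_holds).G → (Fin 2 → ℂ)) ∈ S.holSat hV 2 Γ (S.P 2).weightFunctions :=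
    (S.mem_holSat_iff hV 2 Γ).2 ⟨hFsat, hhol⟩
  have hU := S.clsU_eq_clsAt hHD hI h₁ h₃ hA hι hV 2 ⟨(F : _ → _), hF'⟩ ⟨Γ, hΓ⟩ hFΓ
  rw [clsAt_apply] at hU
  rw [← hU]
  -- binder-2 #104 over sinst-1 #1268∕#1269 and the (Hw₁′) identity
  exact mem_biSup_block_pin_of_line_eq_of_mem_biSup hHD hI h₁ h₃ hA V _ _
    (fun χ => ((pinDatumTwoG V c S hGR hGR₀ hGR₁ hGR₂ hGR₃ χ₀ χ₁ χ₂ χ₃ hι h₁W hV hemb hP hχc eR eS hχ a hω hdefI).coinvRep χ).asModule)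
    (Finset.mem_singleton_self j) hline (fun χ => charTwoDictG V c hGR hGR₂ hGR₃ χ₂ χ)
    (fun χ hχ𝓕 => isAutChar_charTwoDictG_of_weight V c hGR hGR₂ hGR₃ χ₂ hχc hη₁V hη₁W h₁W χ _
      (WeilPairData.forall_weight_of_charInv_mem_weightFunctions _ hχ𝓕) hw)
    (fun χ _ => (dictEquivTwoCanonicalG V c S hGR hGR₀ hGR₁ hGR₂ hGR₃ χ₀ χ₁ χ₂ χ₃ hι h₁W hV hP hχc hη₁V _ _ _ χ).toLinearMap)
    (fun χ _ => LinearEquiv.surjective _) hx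

end Two

/-! ## Slot 3 -/

section Three

variable (hP : (S.P 3).ω = lineRepOf V c.D hGR hGR₀ hGR₁ hGR₂ hGR₃ χ₀ χ₁ χ₂ χ₃ 3)
  (hχc : Continuous fun p => ((χ₃ p : ℂˣ) : ℂ))
  (eR : PosIdx (cmXW (L : Type) (frameD V) (lineVec (L : Type) (dW' c.D 1)) (fun _ => dW'_real c.D 1) ι₁ (HypCensus.cmPlace (L : Type) ι₁)) ≃ Unit)
  (eS : NegIdx (cmXW (L : Type) (frameD V) (lineVec (L : Type) (dW' c.D 1)) (fun _ => dW'_real c.D 1) ι₁ (HypCensus.cmPlace (L : Type) ι₁)) ≃ Empty)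
  (hχ : ∀ u : stabilizer U21 x₀,
    ((lineScalar_three V c.D hGR hGR₂ hGR₃ χ₃ (u : U21) : ℂˣ) : ℂ) *
        ((matA (stabilizerEquivK21.symm u)).det ^ (lineVacExponentsThree V c hGR₃ eR eS).eP *
          sclD (stabilizerEquivK21.symm u) ^ (lineVacExponentsThree V c hGR₃ eR eS).eQ) =
      star (sclD (stabilizerEquivK21.symm u)))
  (a : {v : InfinitePlace ↥(maximalRealSubfield L) // v.IsReal} → ℤ)
  (hω : ∀ b : {v : InfinitePlace ↥(maximalRealSubfield L) // v.IsReal}, b ≠ HypCensus.cmPlace (L : Type) ι₁ →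
    ∀ (u : UnitaryGroup.archLocal (L : Type) 3 (Matrix.diagonal (frameD V)) (cmPlaceOver (L : Type) b)) (ℓ : Module.Dual ℂ (Fin 2 → ℂ)),
      cmArchWeilRep (L : Type) e₁ (frameD V) (frameD_real V) (frameD_ne V) (lineVec (L : Type) (dW' c.D 1)) (fun _ => dW'_real c.D 1)
          (fun _ => dW'_ne c.D 1) hGR₃
          (UnitaryGroup.archSingle (↥(maximalRealSubfield L)) L (IsCMField.complexConj L) 3 (Matrix.diagonal (frameD V))
            (IsCMField.complexConj_ne_one L) (NumberField.complexConj_smul_infinitePlace (L : Type)) (cmPlaceOver (L : Type) b) u, 1)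
          (blockFamilyOfAt (L : Type) e₁ (frameD V) (frameD_real V) (frameD_ne V) (lineVec (L : Type) (dW' c.D 1)) (fun _ => dW'_real c.D 1)
            (fun _ => dW'_ne c.D 1) ι₁ (blockPosEquiv V) (blockNegEquiv V) eR eS (degOnePDual Empty) (binvPi 1) ℓ) =
        (((u : UnitaryGroup.archLocal (L : Type) 3 (Matrix.diagonal (frameD V)) (cmPlaceOver (L : Type) b)) : GL (Fin 3) ℂ) :
            Matrix (Fin 3) (Fin 3) ℂ).det ^ a b •
          blockFamilyOfAt (L : Type) e₁ (frameD V) (frameD_real V) (frameD_ne V) (lineVec (L : Type) (dW' c.D 1)) (fun _ => dW'_real c.D 1)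
            (fun _ => dW'_ne c.D 1) ι₁ (blockPosEquiv V) (blockNegEquiv V) eR eS (degOnePDual Empty) (binvPi 1) ℓ)
  (hdefI : ∀ b : {v : InfinitePlace ↥(maximalRealSubfield L) // v.IsReal}, b ≠ HypCensus.cmPlace (L : Type) ι₁ →
    ∀ u : UnitaryGroup.archLocal (L : Type) 3 (Matrix.diagonal (frameD V)) (cmPlaceOver (L : Type) b),
      ((archScalar_threeG V c.D hGR hGR₂ hGR₃ χ₃
          (UnitaryGroup.archSingle (↥(maximalRealSubfield L)) L (IsCMField.complexConj L) 3 (Matrix.diagonal (frameD V))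
            (IsCMField.complexConj_ne_one L) (NumberField.complexConj_smul_infinitePlace (L : Type)) (cmPlaceOver (L : Type) b) u) : ℂˣ) : ℂ) *
        (((u : UnitaryGroup.archLocal (L : Type) 3 (Matrix.diagonal (frameD V)) (cmPlaceOver (L : Type) b)) : GL (Fin 3) ℂ) :
            Matrix (Fin 3) (Fin 3) ℂ).det ^ a b = 1)



/-- the slot-3 scalar as a `RealScalar`. -/
abbrev aThreeJ : LiuIndex.RealScalar L := ⟨dW' c.D 1, dW'_real c.D 1, dW'_ne c.D 1⟩

/-- sinst-1's twisted slot-3 record IS (#102 `ofCMOf` at `a_3`) twisted by its big character — definitional (`delta` + `rfl`). [folklore] -/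
theorem splitLineThreeTwistedG_eq_ofCMOf_twistBy (hη₁V : ∀ v ∈ CMRat (L : Type) (frameD V), χ₃ (v, 1) = 1) :
    splitLineThreeTwistedG V c hGR hGR₂ hGR₃ χ₃ hη₁V =
      (SplitLineE.ofCMOf V e₁ (LiuIndex.RealScalar.vec (aThreeJ c)) (LiuIndex.RealScalar.vec_real (aThreeJ c))
        (LiuIndex.RealScalar.vec_ne (aThreeJ c)) hGR₃).twistBy (bigCharThree V c hGR hGR₂ hGR₃ χ₃)
        (bigCharThree_isRatTrivial V c hGR hGR₂ hGR₃ χ₃ hη₁V) := by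
  delta ThetaAdelicSide.splitLineThreeTwistedG ThetaAdelicSide.splitLineThreeG
  rfl

/-- the twisted slot-3 record's Gram scalar is `c.D.a 3`. [folklore] -/
theorem splitLineThreeTwistedG_scalar (hη₁V : ∀ v ∈ CMRat (L : Type) (frameD V), χ₃ (v, 1) = 1) :
    (splitLineThreeTwistedG V c hGR hGR₂ hGR₃ χ₃ hη₁V).scalar = c.D.a 3 := by
  rw [splitLineThreeTwistedG_eq_ofCMOf_twistBy]
  show (SplitLineE.ofCMOf V e₁ (LiuIndex.RealScalar.vec (aThreeJ c)) (LiuIndex.RealScalar.vec_real (aThreeJ c))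
        (LiuIndex.RealScalar.vec_ne (aThreeJ c)) hGR₃).scalar = c.D.a 3
  rw [SplitLineE.ofCMOf_scalar]
  rfl

include hGR hGR₀ hGR₁ hGR₂ hGR₃ χ₀ χ₁ χ₂ χ₃ hι h₁W hP hχc hemb eR eS hχ a hω hdefI in
/-- **SLOT 3 OF THE JUNCTION BINDER `hJ`, PIN-GENERICALLY, FOR E's THETA MODEL** over any side family `Sf` with `Sf V c = S`, `S` reading
`lineRepOf … χ₀ χ₁ χ₂ χ₃` at slot 3 (R2 pin: `χ₁ := etaT₁ η ν`): the slot-3 conjunct through the χ₁-TWISTED record, `T := {j₁}`,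
modulo the ONE archimedean identity (`hμ` index side in #S19's split currency ∕ `hw` automorphy side, (Hw₁′)), the pin identities, and the
side facts `hGfin` ∕ `hLF` ∕ `hη₁V` ∕ `hη₁W`. -/
theorem hJ_slot_three_of_lineRepOf
    (Sf : ∀ {L : CMField} {ι₁ : L →+* ℂ} (V : HermSpace3 L ι₁) (c : SeesawCtx L), ThetaAdelicSide V c)
    (hS : Sf V c = S)
    (hGfin : ∀ K : Subgroup ↥V.adelicFin, ThetaDistDatum.satG hV K ≤ S.Gfin) (hLF : (S.P 3).IsLFAction)
    (hη₁V : ∀ v ∈ CMRat (L : Type) (frameD V), χ₃ (v, 1) = 1)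
    (hη₁W : ∀ t₀ ∈ relNormOneRat (↥(maximalRealSubfield L)) L, χ₃ (1, (cmAdelicOneEquivRelNormOne (L : Type)).symm t₀) = 1)
    (hc₁ : Continuous fun v => ((adelicCharThree V c hGR hGR₂ hGR₃ χ₃ v : ℂˣ) : ℂ))
    (hμ : μ (LiuIndex.GramClass.mk (aThreeJ c)) =
      Literature.NumberTheory.Automorphic.charArchType (L : Type) (LiuIndex.centerCharInf V (adelicCharThree V c hGR hGR₂ hGR₃ χ₃))
          (LiuIndex.continuous_centerCharInf V _ hc₁) +
        LiuIndex.centralTypeOf V (aThreeJ c) hGR₃)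
    (hw : ∀ t : ↥(Literature.NumberTheory.Automorphic.relNormOneInfUnits (↥(maximalRealSubfield L)) L),
      (S.P 3).w t *
          ((adelicCharThree V c hGR hGR₂ hGR₃ χ₃ (CMCenter (L : Type) (frameD V)
            ((cmAdelicOneEquivRelNormOne (L : Type)).symm (Literature.NumberTheory.Automorphic.relNormOneInfToIdeles (↥(maximalRealSubfield L)) L t))) : ℂˣ) : ℂ) =
        ((torusScalar_threeG V c.D hGR hGR₂ hGR₃ χ₃
            ((cmAdelicOneEquivRelNormOne (L : Type)).symm (Literature.NumberTheory.Automorphic.relNormOneInfToIdeles (↥(maximalRealSubfield L)) L t)) : ℂˣ) : ℂ)) :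
    ∃ T : Finset (LiuIndex.I V (LiuIndex.repAt (aThreeJ c)) μ),
      (∀ j ∈ T, ∃ z : (L : Type), z ≠ 0 ∧
        (LiuIndex.line V (LiuIndex.repAt (aThreeJ c)) μ j).scalar = z * conjRingHomK L z * c.D.a 3) ∧
      ∀ (Γ : Level V) (hΓ : Γ.BelowConjThree),
        ∀ ω ∈ thetaOf _ (thetaClassInputOf _ (fun V c => thetaSpaceInputOf hHD hI h₁ h₃ Sf V c)) V c 3 Γ,
          ∃ cf : towerLevel hHD hI (ballQuotientUniformisedDatum_of h₁) h₃ hA Γ hΓ,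
            TowerLevel.res hHD hI (ballQuotientUniformisedDatum_of h₁) h₃ hA cf = ω ∧
              (ofLevel hHD hI (ballQuotientUniformisedDatum_of h₁) h₃ hA Γ hΓ cf :
                  (liuDictionaryPin hHD hI h₁ h₃ hA V (LiuIndex.I V (LiuIndex.repAt (aThreeJ c)) μ)
                    (LiuIndex.line V (LiuIndex.repAt (aThreeJ c)) μ)).H) ∈
                ⨆ j' ∈ T, (liuDictionaryPin hHD hI h₁ h₃ hA V (LiuIndex.I V (LiuIndex.repAt (aThreeJ c)) μ)
                  (LiuIndex.line V (LiuIndex.repAt (aThreeJ c)) μ)).block j' := by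
  -- theta-3 #S19: THE index of the twisted slot record, ONCE
  obtain ⟨j, hj1, hline⟩ : ∃ j : LiuIndex.I V (LiuIndex.repAt (aThreeJ c)) μ, j.1 = LiuIndex.GramClass.mk (aThreeJ c) ∧
      LiuIndex.line V (LiuIndex.repAt (aThreeJ c)) μ j = splitLineThreeTwistedG V c hGR hGR₂ hGR₃ χ₃ hη₁V := by
    rw [splitLineThreeTwistedG_eq_ofCMOf_twistBy]
    exact LiuIndex.I.exists_line_eq_twistBy_bigCharOfV_of_eq V μ (LiuIndex.repAt_mk_self (aThreeJ c)) hGR₃ _ _ hc₁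
      (bigCharThree_isRatTrivial V c hGR hGR₂ hGR₃ χ₃ hη₁V) hμ
  refine ⟨{j}, fun j' hj' => ?_, fun Γ hΓ θ hθ => ?_⟩
  · rw [Finset.mem_singleton] at hj'
    subst hj'
    exact exists_isometric_of_line_eq V _ _ hline (splitLineThreeTwistedG_scalar V c hGR hGR₂ hGR₃ χ₃ hη₁V)
  -- sinst-1 #1238: the (J4) lift of the theta class (over the family `Sf`), moved to `S`
  obtain ⟨cl, hclω, -, F, hFsat₀, hpull₀, -⟩ := exists_fixed_adelic_lift_of_mem_thetaOf hHD hI h₁ h₃ Sf V c 3 Γ hV hθ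
  have hFsat : (F : (V.latticeModel printFact_unitaryCompact_holds).G → (Fin 2 → ℂ)) ∈
      adelicThetaSpanSat (S.P 3) S.ιinf (stabilizer U21 x₀).subtype
        (BallForms.isPullbackCocycle_cotangentCocycle.weightOf x₀) (ThetaDistDatum.satG hV Γ.K) (S.P 3).weightFunctions := by
    rw [← hS]; exact hFsat₀
  have hpull : (((pinD hHD hI h₁ h₃ Γ hV).pull cl : weightForms _ _ _) : U21 → Fin 2 → ℂ) =
      (F : (V.latticeModel printFact_unitaryCompact_holds).G → (Fin 2 → ℂ)) ∘ ⇑S.ιinf := by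
    rw [← hS]; exact hpull₀
  have h𝓕 : ∀ f ∈ (S.P 3).weightFunctions,
      ∃ χ : PontryaginDual (↥(relNormOneIdeles (↥(maximalRealSubfield L)) L) ⧸ relNormOneRat (↥(maximalRealSubfield L)) L),
        f = charInv χ := fun f ⟨χ, _, hf⟩ => ⟨χ, hf⟩
  -- binder-1 #R130 at #R129's pin-generic datum
  obtain ⟨hF', hx⟩ := clsU_mem_iSup_block_of_mem_adelicThetaSpanSat_pinThreeG hHD hI h₁ h₃ hA V c S hGR hGR₀ hGR₁ hGR₂ hGR₃
    χ₀ χ₁ χ₂ χ₃ hι hV hemb hP hχc eR eS hχ a hω hdefI h𝓕 hGfin hLF Γ.K hFsat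
  have hhol : IsHolGerm S.ιinf (F : (V.latticeModel printFact_unitaryCompact_holds).G → (Fin 2 → ℂ)) := by
    obtain ⟨i, hi⟩ := (S.mem_holSatU_iff hV 3).1 hF'
    exact ((S.mem_holSat_iff hV 3 i.1).1 hi).2
  -- binder-1 #1242∕#1243: tower vector and restriction
  refine ⟨⟨_, S.towerFamily_mem hHD hI h₁ h₃ hA hι hV hΓ hFsat hhol⟩, ?_, ?_⟩
  · rw [← hclω]
    exact S.res_towerFamily hHD hI h₁ h₃ hA hV hΓ hFsat hhol _ cl hpull
  have hFΓ : (F : (V.latticeModel printFact_unitaryCompact_holds).G → (Fin 2 → ℂ)) ∈ S.holSat hV 3 Γ (S.P 3).weightFunctions :=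
    (S.mem_holSat_iff hV 3 Γ).2 ⟨hFsat, hhol⟩
  have hU := S.clsU_eq_clsAt hHD hI h₁ h₃ hA hι hV 3 ⟨(F : _ → _), hF'⟩ ⟨Γ, hΓ⟩ hFΓ
  rw [clsAt_apply] at hU
  rw [← hU]
  -- binder-2 #104 over sinst-1 #1270∕#1271 and the (Hw₁′) identity
  exact mem_biSup_block_pin_of_line_eq_of_mem_biSup hHD hI h₁ h₃ hA V _ _
    (fun χ => ((pinDatumThreeG V c S hGR hGR₀ hGR₁ hGR₂ hGR₃ χ₀ χ₁ χ₂ χ₃ hι hV hemb hP hχc eR eS hχ a hω hdefI).coinvRep χ).asModule)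
    (Finset.mem_singleton_self j) hline (fun χ => charThreeDictG V c hGR hGR₂ hGR₃ χ₃ χ)
    (fun χ hχ𝓕 => isAutChar_charThreeDictG_of_weight V c hGR hGR₂ hGR₃ χ₃ hχc hη₁V hη₁W h₁W χ _
      (WeilPairData.forall_weight_of_charInv_mem_weightFunctions _ hχ𝓕) hw)
    (fun χ _ => (dictEquivThreeCanonicalG V c S hGR hGR₀ hGR₁ hGR₂ hGR₃ χ₀ χ₁ χ₂ χ₃ hι hV hP hχc hη₁V _ _ _ χ).toLinearMap)
    (fun χ _ => LinearEquiv.surjective _) hx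

end Three

end ThetaAdelicSide
end HodgeCM.Model

end
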